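import Literature.NumberTheory.Automorphic.CaraianiNewtonModularity
import Literature.NumberTheory.EllipticCurves.GaloisAction
import HarnessLib

/-!
# Thorne 2019: elliptic curves over the cyclotomic `ℤ_p`-extension of `ℚ` are modular; the
# point control `E_i(ℚ_∞) = E_i(ℚ)` on `X(b3,b5) ≅ 15A1` and `X(s3,b5) ≅ 15A3` (named facts)

Topic `NumberTheory/Automorphic` (companion of `CaraianiNewtonModularity.lean` — whose predicate
`IsModularEllipticCurve K E` ("geometric CM, or a weight-zero cuspidal `π` of `GL₂(𝔸_K)` whose
`T_w`-eigenvalue is `a_w(E)` at all but finitely many `w`") and model `X0FifteenLegendre` of `X₀(15)`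
we reuse — and of `FreitasLeHungSiksekModularity.lean`, whose conservative vendoring conventions we
follow). NAMED FACTS (D-0014: `def … : Prop`, statement only, no `sorry`), vendored while grounding
route `Langlands/Langlands/HeptagonalTower` (ledger `route-Langlands-HeptagonalTower`): they ground
`Summit.Langlands.Langlands.Theses.HeptagonalTower.Target` on the layers `ℚ_n ⊂ ℚ_∞^{(7)}`
(`Thorne2019_thm1`), `…OddDegreeDoor` (`Thorne2019_lemma3`, with Yoshikawa 2022 Cor. 3.3 (1) for the
odd-degree reduction from `X(s3,b5)` to `X₀(15)`), and the `Γ`-branch of `…KatoRankZeroSeven` /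
`…TorsionSeven` (`Thorne2019_thm5`, `Thorne2019_prop4`).

## Source and what is printed

J. A. Thorne, *Elliptic curves over `ℚ_∞` are modular*, J. Eur. Math. Soc. 21 (2019) 1943–1948
= arXiv:1505.04769 [Thorne2019]; read 2026-08-17 from the arXiv text layer (`lit read
arxiv:1505.04769`, pp. 3–5), verbatim:

* **Theorem 1** (p. 3). "Let `p` be a prime, and let `F` be a number field which is contained in
  the cyclotomic `ℤ_p`-extension of `ℚ`. Let `E` be an elliptic curve over `F`. Then `E` is
  modular." — "an elliptic curve `E` over a number field `F` is said to be modular if there is a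
  regular algebraic automorphic representation `π` of `GL₂(𝔸_F)` which has the same `L`-function
  as `E`."
* **Theorem 2** (p. 4). "Let `E` be an elliptic curve over a totally real number field `F`, and
  suppose that (at least) one of the following is true: • `ρ̄_{E,3}|_{G_{F(ζ₃)}}` is absolutely
  irreducible. • `√5 ∉ F`, and `ρ̄_{E,5}` is irreducible. Then `E` is modular." (Proof: "The second
  part … is [Tho15]" = Thorne, *Automorphy of some residually dihedral Galois representations*,
  Math. Ann. 364 (2016), Thm. 7.6.) The SECOND alternative is vendored (`Thorne2019_thm2_five`) on the
  tree's `WeierstrassCurve.HasIrreducibleModPGaloisRep` (`EllipticCurves/GaloisAction.lean`: the only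
  `Γ_K`-stable subgroups of `E[5](K̄)` are `⊥`, `⊤`); the first alternative needs absolute
  irreducibility on `G_{F(ζ₃)}`, not typed in the tree, and is left out (as in
  `FreitasLeHungSiksekModularity.lean`).
* **Lemma 3** (p. 4). "Let `F` be a totally real field such that `√5 ∉ F`. • If `E` is an elliptic
  curve over `F` which is not modular, then `E` determines an `F`-rational point of one of the curves
  `X(s3, b5)`, `X(b3, b5)`. • If `F/ℚ` is cyclic and `X(s3, b5)(F) = X(s3, b5)(ℚ)`,
  `X(b3, b5)(F) = X(b3, b5)(ℚ)`, then all elliptic curves over `F` are modular."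
* **Proposition 4** (p. 4). "The curve `X(b3, b5)` is isomorphic over `ℚ` to the elliptic curve
  `E₁ : y² + xy + y = x³ + x² − 10x − 10` of Cremona label 15A1. The curve `X(s3, b5)` is
  isomorphic over `ℚ` to the elliptic curve `E₂ : y² + xy + y = x³ + x² − 5x + 2` of Cremona label
  15A3. Both curves have group of rational points isomorphic to `ℤ/2ℤ ⊕ ℤ/4ℤ`. They are related by
  an isogeny of degree 2." (Proof: "See [Fre13]" = Freitas–Le Hung–Siksek 2015, Lemmas 5.6–5.7.)
* **Theorem 5** (p. 4; proof pp. 4–5). "Let `p` be a prime, let `i ∈ {1, 2}`, and let `ℚ_∞` denote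
  the cyclotomic `ℤ_p`-extension of `ℚ`. Then `E_i(ℚ_∞) = E_i(ℚ)`." (Proof: `ρ_{E,l}` surjective for
  `l ≥ 3` by [Ser72] and minimal discriminant `15⁴`; Rouse–Zureick-Brown for `l = 2`; finiteness of
  `E(ℚ_∞)` from `L(E,1)/Ω_E = 1/8`, `Tam(E) = 8`: Greenberg [Gre99] + Kato for good ordinary `p`,
  Kato–Kurihara [Kur02] for supersingular `p`, Skinner [Ski15] for `p = 3, 5`.) Inside the proof
  (p. 4): "It is known that the Galois representation `ρ_{E,l} : G_ℚ → GL₂(ℤ_l)` is surjective for all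
  primes `l ≥ 3`. (For example, this can be shown using [Ser72] and the fact that `E` has minimal
  discriminant `15⁴`.)" — vendored in its mod-`l` form (`Thorne2019_surjective_modEll_E₁`, on the
  tree's `WeierstrassCurve.HasSurjectiveModNGaloisRep`), the input of the torsion-rigidity argument.

## Design (read before citing)

* "`F` is contained in the cyclotomic `ℤ_p`-extension `ℚ_∞` of `ℚ`" is rendered by
  `Thorne2019.IsInCyclotomicZpExtension p F`: `F` is totally real, embeds (as a ring) in some
  `ℚ(ζ_{p^{m+1}})`, and `[F : ℚ]` is a power of `p`. This is faithful: for odd `p`,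
  `Gal(ℚ(ζ_{p^{m+1}})/ℚ)` is cyclic of order `(p−1)p^m`, so its unique subfield of degree `p^k` is
  the layer `ℚ_k ⊂ ℚ_∞` (automatically totally real); for `p = 2` the totally real subfields of
  `ℚ(ζ_{2^{m+1}})` are the subfields of `ℚ(ζ_{2^{m+1}})⁺ = ℚ_{m−1}`, a cyclic `2`-extension, i.e. again
  exactly the layers (total reality excludes `ℚ(i)`, `ℚ(√−2)`, …); conversely every number field
  inside `ℚ_∞` has these three properties. Modularity and point sets are invariant under field
  isomorphism, so "contained in" versus "embeds in" is immaterial.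
* Thorne's "modular" (same `L`-function as a regular algebraic `π`) IMPLIES the tree's
  `IsModularEllipticCurve F E` (cofinite `T_w`-eigenvalue match, weight zero, or CM) through the
  dictionary of `CaraianiNewtonModularity.lean`; as in `FreitasLeHungSiksekModularity.lean` each
  modularity fact below is therefore AT MOST AS STRONG as the printed theorem.
* "`X(b3,b5)(F) = X(b3,b5)(ℚ)`" is rendered, through Proposition 4, on Thorne's printed model `E₁`:
  every `F`-rational affine point of `E₁` has both coordinates in (the image of) `ℚ`
  (`Thorne2019.PointsRational E₁ F`; the point at infinity is rational on both sides); likewise for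
  `X(s3,b5)` and `E₂`. "`F/ℚ` cyclic" = `IsGalois ℚ F ∧ IsCyclic (F ≃ₐ[ℚ] F)`; "`√5 ∉ F`" =
  `¬ IsSquare (5 : F)`.
* Proposition 4's "group of rational points `≅ ℤ/2 ⊕ ℤ/4`" is rendered EXTENSIONALLY as the list of
  the eight rational points of each printed model (`Thorne2019_prop4`): the seven affine points were
  found by a height search and are CHECKED below to lie on the curves (`Thorne2019.E₁_equation_of_mem`,
  `Thorne2019.E₂_equation_of_mem`, kernel-verified); that there are no others is the printed
  statement `|E_i(ℚ)| = 8` (Cremona's table, class 15a).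
* Bridge to the tree's model of `X₀(15)`: `X0FifteenLegendre` (`y² = x(x+16)(x+25)`, Caraiani–Newton)
  is `ℚ`-isomorphic to `E₁` by the admissible change of variables `(u, r, s, t) = (1/2, 3, −1/2, −2)`,
  i.e. `x_L = 4x − 12`, `y_L = 8y + 4x + 4` — PROVED below (`Thorne2019.variableChange_E₁`), so the
  route's hypotheses on Legendre-model points transport to `E₁` by this explicit substitution (it is
  defined over `ℚ`, hence preserves `ℚ`-rationality of coordinates in both directions).

## What these facts ground (route HeptagonalTower; differences recorded, not hidden)

* `Target` restricted to the layers `K = ℚ_n` of `7`-power degree IS `Thorne2019_thm1` at `p = 7`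
  (same rendering of "modular"); the cubic layer `ℚ(ζ₇)⁺` is Derickx–Najman–Siksek 2020, Thm. 1.1
  (not vendored here); the layers with `21 ∣ [K:ℚ]` are NEW.
* `OddDegreeDoor` = `Thorne2019_lemma3` ∘ (subfields of `ℚ(ζ_{7^{n+1}})` are cyclic over `ℚ` and miss
  `√5`) ∘ (Yoshikawa 2022, Lemma 3.2 / Cor. 3.3 (1): for `[K:ℚ]` odd, `X₀(15)(K) = X₀(15)(ℚ)` implies
  `X(s3,b5)(K) = X(s3,b5)(ℚ)` via the degree-2 isogeny `E₂ → E₁` over `ℚ`) ∘ (the Legendre bridge).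
* `KatoRankZeroSeven` and `TorsionSeven` restricted to `K ⊂ ℚ_∞^{(7)}` follow from `Thorne2019_thm5`
  + `Thorne2019_prop4` + the Legendre bridge; their `Δ`-branches (`3 ∣ [K:ℚ]`) are NEW as statements
  (for `TorsionSeven` the printed input is `Thorne2019_surjective_modEll_E₁` + `Thorne2019_prop4`, the
  rest being the elementary odd-index argument of the item's docstring).
* The layer-2 split `NonModularLocus15` foreseen by the route starts from `Thorne2019_thm2_five`.

## Mathlib / tree search

Tree: `IsModularEllipticCurve`, `X0FifteenLegendre`, `FreitasLeHungSiksek2015_thm1/thm5`,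
`kato_finite_chiPart_of_twistedLValue_ne_zero` (Kato Cor. 14.3 (2)), `pollack_exists_plusMinusPAdicLFunction`;
nothing on `ℤ_p`-towers (`lean search` for `Thorne2019`, `Q_∞`/`Qinfty`, `CyclotomicField.*IsModular`:
no hits). Mathlib: `WeierstrassCurve.VariableChange` (`C • W`, `variableChange_aᵢ`),
`WeierstrassCurve.Affine.Equation`, `CyclotomicField`, `NumberField.IsTotallyReal`, `IsGalois`, `IsCyclic`.
Users take `(h : Thorne2019_thm1)` etc.
-/

noncomputable section

namespace Literature.NumberTheory.Automorphic

open NumberField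

namespace Thorne2019

/-- Thorne's model of `X(b3, b5) = X₀(15)`: the curve `E₁ : y² + xy + y = x³ + x² − 10x − 10` of
Cremona label 15A1 (Weierstrass coefficients `[1, 1, 1, −10, −10]`).
[cite: Thorne2019, Prop. 4] -/
def E₁ : WeierstrassCurve ℚ := ⟨1, 1, 1, -10, -10⟩

/-- Thorne's model of `X(s3, b5)`: the curve `E₂ : y² + xy + y = x³ + x² − 5x + 2` of Cremona label
15A3 (Weierstrass coefficients `[1, 1, 1, −5, 2]`). [cite: Thorne2019, Prop. 4] -/
def E₂ : WeierstrassCurve ℚ := ⟨1, 1, 1, -5, 2⟩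

/-- "`W(K) = W(ℚ)`" for a Weierstrass curve `W` over `ℚ` and a `ℚ`-algebra `K` (a field): every
`K`-rational affine point of `W` has both coordinates in the image of `ℚ` (the point at infinity is
rational on both sides). [folklore] -/
def PointsRational (W : WeierstrassCurve ℚ) (K : Type) [Field K] [Algebra ℚ K] : Prop :=
  ∀ x y : K, (W.baseChange K).toAffine.Equation x y →
    x ∈ Set.range (algebraMap ℚ K) ∧ y ∈ Set.range (algebraMap ℚ K)

/-- "`K` is (isomorphic to) a number field contained in the cyclotomic `ℤ_p`-extension `ℚ_∞` of
`ℚ`" (for a prime `p`): `K` is totally real, embeds in some `ℚ(ζ_{p^{m+1}})`, and `[K : ℚ]` is a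
power of `p` (see the design notes: these are exactly the layers `ℚ_k`, for every prime `p` including
`2`). [folklore] -/
def IsInCyclotomicZpExtension (p : ℕ) (K : Type) [Field K] [NumberField K] :
    Prop :=
  IsTotallyReal K ∧
    (∃ m : ℕ, Nonempty (K →+* CyclotomicField (p ^ (m + 1)) ℚ)) ∧
      ∃ k : ℕ, Module.finrank ℚ K = p ^ k

/-- The seven affine rational points of `E₁` (with `O`, the eight points of `E₁(ℚ) ≅ ℤ/2 ⊕ ℤ/4`):
`2`-torsion `(−13/4, 9/8)`, `(−1, 0)`, `(3, −2)` (the points with `2y + x + 1 = 0`) and the four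
points of order `4`: `(−2, −2)`, `(−2, 3)`, `(8, −27)`, `(8, 18)`. [cite: Thorne2019, Prop. 4] -/
def E₁Points : Set (ℚ × ℚ) :=
  {(-13/4, 9/8), (-2, -2), (-2, 3), (-1, 0), (3, -2), (8, -27), (8, 18)}

/-- The seven affine rational points of `E₂` (with `O`, the eight points of `E₂(ℚ) ≅ ℤ/2 ⊕ ℤ/4`):
`2`-torsion `(−3, 1)`, `(3/4, −7/8)`, `(1, −1)` and the four points of order `4`: `(0, −2)`, `(0, 1)`,
`(2, −4)`, `(2, 1)`. [cite: Thorne2019, Prop. 4] -/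
def E₂Points : Set (ℚ × ℚ) :=
  {(-3, 1), (0, -2), (0, 1), (3/4, -7/8), (1, -1), (2, -4), (2, 1)}

/-- Sanity check (kernel-verified): the seven listed points lie on `E₁`. [folklore] -/
theorem E₁_equation_of_mem {x y : ℚ} (h : (x, y) ∈ E₁Points) : E₁.toAffine.Equation x y := by
  simp only [E₁Points, Set.mem_insert_iff, Set.mem_singleton_iff, Prod.mk.injEq] at h
  rw [WeierstrassCurve.Affine.equation_iff]
  rcases h with ⟨rfl, rfl⟩ | ⟨rfl, rfl⟩ | ⟨rfl, rfl⟩ | ⟨rfl, rfl⟩ | ⟨rfl, rfl⟩ | ⟨rfl, rfl⟩ |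
    ⟨rfl, rfl⟩ <;> norm_num [E₁]

/-- Sanity check (kernel-verified): the seven listed points lie on `E₂`. [folklore] -/
theorem E₂_equation_of_mem {x y : ℚ} (h : (x, y) ∈ E₂Points) : E₂.toAffine.Equation x y := by
  simp only [E₂Points, Set.mem_insert_iff, Set.mem_singleton_iff, Prod.mk.injEq] at h
  rw [WeierstrassCurve.Affine.equation_iff]
  rcases h with ⟨rfl, rfl⟩ | ⟨rfl, rfl⟩ | ⟨rfl, rfl⟩ | ⟨rfl, rfl⟩ | ⟨rfl, rfl⟩ | ⟨rfl, rfl⟩ |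
    ⟨rfl, rfl⟩ <;> norm_num [E₂]

/-- The admissible change of variables carrying `E₁` to the tree's Legendre model of `X₀(15)`:
`(u, r, s, t) = (1/2, 3, −1/2, −2)`, i.e. `x = x_L/4 + 3`, `y = y_L/8 − x_L/8 − 2`, equivalently
`x_L = 4x − 12`, `y_L = 8y + 4x + 4`. [folklore] -/
def legendreChange : WeierstrassCurve.VariableChange ℚ :=
  ⟨⟨2⁻¹, 2, by norm_num, by norm_num⟩, 3, -2⁻¹, -2⟩

/-- **The Legendre bridge** (proved): Thorne's `E₁` (15A1) becomes the tree's `X0FifteenLegendre`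
(`y² = x(x+16)(x+25)`) under `legendreChange`; in particular the two are `ℚ`-isomorphic and
`K`-points correspond by `x_L = 4x − 12`, `y_L = 8y + 4x + 4`, a substitution defined over `ℚ`.
[folklore] -/
theorem variableChange_E₁ : legendreChange • E₁ = X0FifteenLegendre := by
  ext <;> simp only [WeierstrassCurve.variableChange_a₁, WeierstrassCurve.variableChange_a₂,
    WeierstrassCurve.variableChange_a₃, WeierstrassCurve.variableChange_a₄,
    WeierstrassCurve.variableChange_a₆, legendreChange, E₁, X0FifteenLegendre] <;> norm_num

/-- `E₁` has discriminant `Δ = 15⁴ = 50625` (it is a minimal model of 15A1). [cite: Thorne2019, proof of Thm. 5] -/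
theorem E₁_Δ : E₁.Δ = 50625 := by
  norm_num [E₁, WeierstrassCurve.Δ, WeierstrassCurve.b₂, WeierstrassCurve.b₄, WeierstrassCurve.b₆,
    WeierstrassCurve.b₈]

/-- `E₁` is an elliptic curve over `ℚ` (`Δ ≠ 0`). [folklore] -/
instance E₁.isElliptic : E₁.IsElliptic := by
  rw [WeierstrassCurve.isElliptic_iff, E₁_Δ]
  norm_num

/-- `E₂` has discriminant `Δ = 3² · 5² = 225`. [folklore] -/
theorem E₂_Δ : E₂.Δ = 225 := by
  norm_num [E₂, WeierstrassCurve.Δ, WeierstrassCurve.b₂, WeierstrassCurve.b₄, WeierstrassCurve.b₆,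
    WeierstrassCurve.b₈]

/-- `E₂` is an elliptic curve over `ℚ` (`Δ ≠ 0`). [folklore] -/
instance E₂.isElliptic : E₂.IsElliptic := by
  rw [WeierstrassCurve.isElliptic_iff, E₂_Δ]
  norm_num

end Thorne2019

/-- **Thorne 2019, Theorem 1: elliptic curves over `ℚ_∞` are modular.** For every prime `p` and every
number field `K` contained in the cyclotomic `ℤ_p`-extension of `ℚ` (`Thorne2019.IsInCyclotomicZpExtension
p K`: totally real, embeds in some `ℚ(ζ_{p^{m+1}})`, degree a power of `p`), every integral
Weierstrass model `E` over `𝓞 K` with `Δ(E) ≠ 0` is modular (`IsModularEllipticCurve K E`, the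
cofinite-trace rendering — implied by the printed `L`-function equality). Statement only. Grounds
`Summit.Langlands.Langlands.Theses.HeptagonalTower.Target` on the layers of `7`-power degree.
[cite: Thorne2019, Thm. 1] -/
def Thorne2019_thm1 : Prop :=
  ∀ (p : ℕ), p.Prime → ∀ (K : Type) [Field K] [NumberField K],
    Thorne2019.IsInCyclotomicZpExtension p K →
      ∀ E : WeierstrassCurve (𝓞 K), E.Δ ≠ 0 → IsModularEllipticCurve K E

/-- **Thorne 2019, Lemma 3 (second part), with Proposition 4.** Let `K` be a totally real number
field with `√5 ∉ K` and `K/ℚ` cyclic (Galois with cyclic group). If every `K`-rational point of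
`X(b3,b5) ≅ E₁` (15A1) and of `X(s3,b5) ≅ E₂` (15A3) is `ℚ`-rational, then every elliptic curve
over `K` (integral model, `Δ ≠ 0`) is modular (`IsModularEllipticCurve K E`). Statement only
(printed proof: Thm. 2 = Kisin/Langlands–Tunnell/FLHS at `3` and Thorne 2016 at `5`, modularity over
`ℚ`, cyclic base change [Lan80]). Grounds `Summit.Langlands.Langlands.Theses.HeptagonalTower.OddDegreeDoor`
(together with Yoshikawa 2022, Cor. 3.3 (1), and `Thorne2019.variableChange_E₁`).
[cite: Thorne2019, Lemma 3 and Prop. 4] -/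
def Thorne2019_lemma3 : Prop :=
  ∀ (K : Type) [Field K] [NumberField K], IsTotallyReal K → ¬ IsSquare (5 : K) →
    IsGalois ℚ K → IsCyclic (K ≃ₐ[ℚ] K) →
      Thorne2019.PointsRational Thorne2019.E₁ K → Thorne2019.PointsRational Thorne2019.E₂ K →
        ∀ E : WeierstrassCurve (𝓞 K), E.Δ ≠ 0 → IsModularEllipticCurve K E

/-- **Thorne 2019, Theorem 5: `E_i(ℚ_∞) = E_i(ℚ)`.** For every prime `p` and every number field `K`
inside the cyclotomic `ℤ_p`-extension of `ℚ`, every `K`-rational point of `E₁` (15A1 `≅ X₀(15)`) and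
of `E₂` (15A3 `≅ X(s3,b5)`) is `ℚ`-rational. Statement only (printed proof: Serre 1972 /
Rouse–Zureick-Brown for torsion; Greenberg 1999 + Kato, Kato–Kurihara 2002 at supersingular `p`
(e.g. `p = 7`, `a₇ = 0`), Skinner at `p = 3, 5`, from `L(E,1)/Ω_E = 1/8`, `Tam(E) = 8`). Grounds the
`Γ`-branch (`K ⊂ ℚ_∞^{(7)}`) of `Summit.Langlands.Langlands.Theses.HeptagonalTower.KatoRankZeroSeven`
and `…TorsionSeven`. [cite: Thorne2019, Thm. 5] -/
def Thorne2019_thm5 : Prop :=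
  ∀ (p : ℕ), p.Prime → ∀ (K : Type) [Field K] [NumberField K],
    Thorne2019.IsInCyclotomicZpExtension p K →
      Thorne2019.PointsRational Thorne2019.E₁ K ∧ Thorne2019.PointsRational Thorne2019.E₂ K

/-- **Thorne 2019, Proposition 4 (the rational points): `E₁(ℚ) ≅ E₂(ℚ) ≅ ℤ/2 ⊕ ℤ/4`**, rendered
extensionally: the affine rational points of `E₁` are exactly the seven of `Thorne2019.E₁Points`
and those of `E₂` the seven of `Thorne2019.E₂Points` (membership ⇒ on the curve is proved above;
the converse — no other rational points — is the printed `|E_i(ℚ)| = 8`, Cremona class 15a).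
Statement only. [cite: Thorne2019, Prop. 4] -/
def Thorne2019_prop4 : Prop :=
  (∀ x y : ℚ, Thorne2019.E₁.toAffine.Equation x y → (x, y) ∈ Thorne2019.E₁Points) ∧
    ∀ x y : ℚ, Thorne2019.E₂.toAffine.Equation x y → (x, y) ∈ Thorne2019.E₂Points

/-- **Thorne 2019, Theorem 2 (second alternative) = Thorne 2016, Thm. 7.6.** Let `K` be a totally
real number field with `√5 ∉ K` and `E/K` an elliptic curve (integral model, `Δ ≠ 0`) whose mod-`5`
Galois representation `ρ̄_{E,5} : Γ_K → Aut(E[5](K̄))` is irreducible (the tree's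
`HasIrreducibleModPGaloisRep 5` on `E.baseChange K`: no `Γ_K`-stable subgroup of `E[5]` other than
`⊥`, `⊤`, i.e. no `K`-rational `5`-isogeny). Then `E` is modular (`IsModularEllipticCurve K E`).
Statement only. Grounds the layer-2 split `NonModularLocus15` of
`Summit.Langlands.Langlands.Theses.HeptagonalTower.OddDegreeDoor`. [cite: Thorne2019, Thm. 2] -/
def Thorne2019_thm2_five : Prop :=
  ∀ (K : Type) [Field K] [NumberField K], IsTotallyReal K → ¬ IsSquare (5 : K) →
    ∀ E : WeierstrassCurve (𝓞 K), E.Δ ≠ 0 →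
      (E.baseChange K).HasIrreducibleModPGaloisRep 5 → IsModularEllipticCurve K E

/-- **Surjectivity of the mod-`l` representations of 15A1, `l ≥ 3`** (Thorne 2019, proof of Thm. 5:
"`ρ_{E,l} : G_ℚ → GL₂(ℤ_l)` is surjective for all primes `l ≥ 3`", by Serre 1972 and the minimal
discriminant `15⁴`; also Yoshikawa 2022, Lemma 4.1 (1), from LMFDB), in the weaker mod-`l` form the
tree can state: for every prime `l ≥ 3`, `ρ̄_{E₁,l} : Γ_ℚ → Aut(E₁[l](ℚ̄))` is surjective
(`HasSurjectiveModNGaloisRep`). Statement only. Grounds the image input of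
`Summit.Langlands.Langlands.Theses.HeptagonalTower.TorsionSeven`.
[cite: Thorne2019, proof of Thm. 5 (p. 1945)] -/
def Thorne2019_surjective_modEll_E₁ : Prop :=
  ∀ l : ℕ, l.Prime → 3 ≤ l → Thorne2019.E₁.HasSurjectiveModNGaloisRep (l : ℤ)

end Literature.NumberTheory.Automorphic
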